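import Mathlib
import HarnessLib
import Summits.FinalStateConjecture.Statement
import Literature.Geometry.Lorentzian.LandauLifshitzPseudotensor

/-!
# Route EIHFluxBalance — `InertialRecession`, re-charting: Leibniz bookkeeping for slowly varying
# frames (iterated lab-time derivatives of bilinear expressions tending to zero)

Helper file for the crux `stmt-FinalStateConjecture-10166`
(`Summit.FinalStateConjecture.FinalStateConjecture.Theses.EIHFluxBalance.InertialRecession`),
line `sublinear-is-free-clean-window-charges`, stub `stub_rechart` (the transfer P2).

The stabiliser-free frame `Λ̃ᵢ(t) = (uᵢ, pᵢ, qᵢ, sᵢ)` of a rotating hole used by the hole charts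
is characterised by the transport law `p′ = η(p, u′) u − η(p, s′) s` (no rotation in the
`p–q` plane); third-order slaving gives `u^{(m)}, s^{(m)} → 0` (`1 ≤ m ≤ 3`) and one wants the
same for `p`, `q`, hence for `Λ̃ᵢ`. This file is the generic real-variable bookkeeping:

* `iteratedDeriv_clm_apply_const` — `(t ↦ A(t) v)^{(n)} = A^{(n)}(t) v`;
* `opNorm_le_sum_norm_apply_basisVector` — `‖A‖ ≤ Σₖ ‖A eₖ‖` on `E4`;
* `tendsto_iteratedDeriv_bilinear_zero` (and `…_zero'`) — if the derivatives of `f` of orders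
  `≤ n` are eventually bounded and those of `g` tend to `0`, then `(B(f, g))^{(n)} → 0`
  (Mathlib's Leibniz bound `ContinuousLinearMap.norm_iteratedFDeriv_le_of_bilinear`);
* `tendsto_iteratedDeriv_of_transport'` (registered one-line form unprimed) — the transport law with bounded `u, s, p` and
  `u^{(m)}, s^{(m)} → 0` (`1 ≤ m ≤ k`) forces `p^{(m)} → 0` (`1 ≤ m ≤ k`), by induction on the
  order.

[folklore calculus]
-/

noncomputable section

set_option linter.dupNamespace false

open Set Filter Function Topology Literature.Geometry.Lorentzian
open scoped ContDiff BigOperators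

namespace Summit.FinalStateConjecture.FinalStateConjecture.Theorems.SublinearIsFree.Rechart

section Generic

variable {E F G : Type*} [NormedAddCommGroup E] [NormedSpace ℝ E] [NormedAddCommGroup F]
  [NormedSpace ℝ F] [NormedAddCommGroup G] [NormedSpace ℝ G]

/-- Iterated derivatives commute with a fixed continuous linear map on the left. [folklore] -/
theorem iteratedDeriv_clm_comp (L : F →L[ℝ] G) {f : ℝ → F} (hf : ContDiff ℝ ∞ f) (n : ℕ)
    (t : ℝ) : iteratedDeriv n (fun s ↦ L (f s)) t = L (iteratedDeriv n f t) := by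
  rw [iteratedDeriv_eq_iteratedFDeriv, iteratedDeriv_eq_iteratedFDeriv,
    show (fun s ↦ L (f s)) = L ∘ f from rfl,
    L.iteratedFDeriv_comp_left (hf.contDiffAt (x := t)) (i := n) (by exact_mod_cast le_top),
    ContinuousLinearMap.compContinuousMultilinearMap_coe, Function.comp_apply]

/-- Evaluation at a fixed vector commutes with iterated derivatives of an operator path:
`(t ↦ A(t) v)^{(n)} = A^{(n)}(t) v`. [folklore] -/
theorem iteratedDeriv_clm_apply_const {A : ℝ → E →L[ℝ] G} (hA : ContDiff ℝ ∞ A) (v : E)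
    (n : ℕ) (t : ℝ) : iteratedDeriv n (fun s ↦ A s v) t = iteratedDeriv n A t v :=
  iteratedDeriv_clm_comp (ContinuousLinearMap.apply ℝ G v) hA n t

/-- **Leibniz decay**: if the derivatives of `f` of orders `≤ n` are eventually bounded and those
of `g` tend to `0`, then the `n`-th derivative of `t ↦ B (f t) (g t)` tends to `0`. [folklore] -/
theorem tendsto_iteratedDeriv_bilinear_zero (B : E →L[ℝ] F →L[ℝ] G) {f : ℝ → E} {g : ℝ → F}
    (hf : ContDiff ℝ ∞ f) (hg : ContDiff ℝ ∞ g) (n : ℕ)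
    (hfb : ∀ i ≤ n, ∃ K : ℝ, ∀ᶠ t in atTop, ‖iteratedDeriv i f t‖ ≤ K)
    (hg0 : ∀ i ≤ n, Tendsto (fun t ↦ iteratedDeriv i g t) atTop (𝓝 0)) :
    Tendsto (fun t ↦ iteratedDeriv n (fun s ↦ B (f s) (g s)) t) atTop (𝓝 0) := by
  rw [tendsto_zero_iff_norm_tendsto_zero]
  -- the Leibniz bound
  have hle : ∀ t, ‖iteratedDeriv n (fun s ↦ B (f s) (g s)) t‖ ≤
      ‖B‖ * ∑ i ∈ Finset.range (n + 1), (n.choose i : ℝ) * ‖iteratedDeriv i f t‖ *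
        ‖iteratedDeriv (n - i) g t‖ := by
    intro t
    have h := B.norm_iteratedFDeriv_le_of_bilinear hf hg t (n := n) (by exact_mod_cast le_top)
    simpa only [norm_iteratedFDeriv_eq_norm_iteratedDeriv] using h
  refine squeeze_zero' (Eventually.of_forall fun t ↦ norm_nonneg _) (Eventually.of_forall hle) ?_
  rw [← mul_zero ‖B‖]
  refine Tendsto.const_mul _ ?_
  rw [← Finset.sum_const_zero]
  refine tendsto_finsetSum _ fun i hi ↦ ?_
  have hi' : i ≤ n := Nat.lt_succ_iff.mp (Finset.mem_range.mp hi)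
  obtain ⟨K, hK⟩ := hfb i hi'
  have hg' : Tendsto (fun t ↦ ‖iteratedDeriv (n - i) g t‖) atTop (𝓝 0) :=
    (tendsto_zero_iff_norm_tendsto_zero.mp (hg0 (n - i) (Nat.sub_le n i)))
  have hlim : Tendsto (fun t ↦ (n.choose i : ℝ) * K * ‖iteratedDeriv (n - i) g t‖) atTop (𝓝 0) := by
    simpa using hg'.const_mul ((n.choose i : ℝ) * K)
  refine squeeze_zero' (Eventually.of_forall fun t ↦ by positivity) ?_ hlim
  filter_upwards [hK] with t ht
  have h1 : 0 ≤ ‖iteratedDeriv (n - i) g t‖ := norm_nonneg _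
  have h2 : 0 ≤ (n.choose i : ℝ) := Nat.cast_nonneg _
  calc (n.choose i : ℝ) * ‖iteratedDeriv i f t‖ * ‖iteratedDeriv (n - i) g t‖
      ≤ (n.choose i : ℝ) * K * ‖iteratedDeriv (n - i) g t‖ := by gcongr

/-- `tendsto_iteratedDeriv_bilinear_zero` with the roles of the two arguments exchanged (apply it
to `B.flip`). [folklore] -/
theorem tendsto_iteratedDeriv_bilinear_zero' (B : E →L[ℝ] F →L[ℝ] G) {f : ℝ → E} {g : ℝ → F}
    (hf : ContDiff ℝ ∞ f) (hg : ContDiff ℝ ∞ g) (n : ℕ)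
    (hf0 : ∀ i ≤ n, Tendsto (fun t ↦ iteratedDeriv i f t) atTop (𝓝 0))
    (hgb : ∀ i ≤ n, ∃ K : ℝ, ∀ᶠ t in atTop, ‖iteratedDeriv i g t‖ ≤ K) :
    Tendsto (fun t ↦ iteratedDeriv n (fun s ↦ B (f s) (g s)) t) atTop (𝓝 0) :=
  tendsto_iteratedDeriv_bilinear_zero B.flip hg hf n hgb hf0

omit [NormedSpace ℝ E] in
/-- A function tending to `0` is eventually bounded in norm (by `1`). [folklore] -/
theorem exists_eventually_norm_le_of_tendsto_zero {φ : ℝ → E}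
    (h : Tendsto φ atTop (𝓝 0)) : ∃ K : ℝ, ∀ᶠ t in atTop, ‖φ t‖ ≤ K :=
  ⟨1, ((tendsto_zero_iff_norm_tendsto_zero.mp h).eventually_lt_const one_pos).mono
    fun _ ht ↦ ht.le⟩

end Generic

/-- **The operator norm on `E4` is controlled by the columns**: `‖A‖ ≤ Σₖ ‖A eₖ‖`. [folklore] -/
theorem opNorm_le_sum_norm_apply_basisVector {G : Type*} [NormedAddCommGroup G] [NormedSpace ℝ G]
    (A : E4 →L[ℝ] G) : ‖A‖ ≤ ∑ k : Fin 4, ‖A (E4.basisVector k)‖ := by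
  refine ContinuousLinearMap.opNorm_le_bound _ (Finset.sum_nonneg fun _ _ ↦ norm_nonneg _)
    fun v ↦ ?_
  have hv : v = ∑ k : Fin 4, v k • E4.basisVector k := by
    ext j
    simp [Fin.sum_univ_four, E4.basisVector]
    fin_cases j <;> simp
  have hcomp : ∀ k : Fin 4, |v k| ≤ ‖v‖ := fun k ↦ by
    rw [← Real.norm_eq_abs]
    exact PiLp.norm_apply_le v k
  calc ‖A v‖ = ‖∑ k : Fin 4, v k • A (E4.basisVector k)‖ := by
        conv_lhs => rw [hv]
        simp [map_sum, map_smul]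
    _ ≤ ∑ k : Fin 4, ‖v k • A (E4.basisVector k)‖ := norm_sum_le _ _
    _ = ∑ k : Fin 4, |v k| * ‖A (E4.basisVector k)‖ := by
        simp [norm_smul, Real.norm_eq_abs]
    _ ≤ ∑ k : Fin 4, ‖v‖ * ‖A (E4.basisVector k)‖ := by
        gcongr with k
        exact hcomp k
    _ = (∑ k : Fin 4, ‖A (E4.basisVector k)‖) * ‖v‖ := by rw [← Finset.mul_sum, mul_comm]

/-- **Decay of an operator path from the decay of its columns.** [folklore] -/
theorem tendsto_iteratedDeriv_clm_zero_of_columns {A : ℝ → E4 →L[ℝ] E4} (hA : ContDiff ℝ ∞ A)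
    (n : ℕ) (h : ∀ k : Fin 4, Tendsto (fun t ↦ iteratedDeriv n (fun s ↦ A s (E4.basisVector k)) t)
      atTop (𝓝 0)) :
    Tendsto (fun t ↦ iteratedDeriv n A t) atTop (𝓝 0) := by
  rw [tendsto_zero_iff_norm_tendsto_zero]
  have hle : ∀ t, ‖iteratedDeriv n A t‖ ≤
      ∑ k : Fin 4, ‖iteratedDeriv n (fun s ↦ A s (E4.basisVector k)) t‖ := fun t ↦ by
    simp only [iteratedDeriv_clm_apply_const hA]
    exact opNorm_le_sum_norm_apply_basisVector _
  refine squeeze_zero' (Eventually.of_forall fun t ↦ norm_nonneg _) (Eventually.of_forall hle) ?_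
  rw [← Finset.sum_const_zero]
  exact tendsto_finsetSum _ fun k _ ↦ tendsto_zero_iff_norm_tendsto_zero.mp (h k)

/-! ### The transport law forces decay of the transported vector's derivatives -/

/-- **Transport decay.** Let `u, s, p : ℝ → E4` be smooth and bounded, and let `p` obey the
transport law `p′ = η(p, u′) u − η(p, s′) s` (Fermi–Walker-type transport in the frame
`(u, ·, ·, s)`, no rotation in the complementary plane). If the derivatives of `u` and `s` of
orders `1 … k` tend to `0`, so do those of `p`: by induction on the order, every term of the
Leibniz expansion of `(p′)^{(m)}` carries a factor `u^{(j)}` or `s^{(j)}` with `j ≥ 1`, the other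
factors being eventually bounded. [folklore] -/
theorem tendsto_iteratedDeriv_of_transport' {u s p : ℝ → E4} {C : ℝ} (k : ℕ)
    (hu : ContDiff ℝ ∞ u) (hs : ContDiff ℝ ∞ s) (hp : ContDiff ℝ ∞ p)
    (hub : ∀ t, ‖u t‖ ≤ C) (hsb : ∀ t, ‖s t‖ ≤ C) (hpb : ∀ t, ‖p t‖ ≤ C)
    (hode : ∀ t, deriv p t = (Minkowski.bilin (p t) (deriv u t)) • u t -
      (Minkowski.bilin (p t) (deriv s t)) • s t)
    (hu0 : ∀ m, 1 ≤ m → m ≤ k → Tendsto (fun t ↦ iteratedDeriv m u t) atTop (𝓝 0))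
    (hs0 : ∀ m, 1 ≤ m → m ≤ k → Tendsto (fun t ↦ iteratedDeriv m s t) atTop (𝓝 0)) :
    ∀ m, 1 ≤ m → m ≤ k → Tendsto (fun t ↦ iteratedDeriv m p t) atTop (𝓝 0) := by
  -- smoothness of the derivatives
  have hu' : ContDiff ℝ ∞ (deriv u) := (contDiff_infty_iff_deriv.mp hu).2
  have hs' : ContDiff ℝ ∞ (deriv s) := (contDiff_infty_iff_deriv.mp hs).2
  -- the two bilinear maps: `η : E4 → E4 → ℝ` and scalar multiplication `ℝ → E4 → E4`
  set η : E4 →L[ℝ] E4 →L[ℝ] ℝ := Minkowski.bilin with hη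
  set S : ℝ →L[ℝ] E4 →L[ℝ] E4 := ContinuousLinearMap.lsmul ℝ ℝ with hS
  have hηp : ContDiff ℝ ∞ fun t ↦ η (p t) := η.contDiff.comp hp
  have hg₁ : ContDiff ℝ ∞ fun t ↦ η (p t) (deriv u t) := hηp.clm_apply hu'
  have hg₂ : ContDiff ℝ ∞ fun t ↦ η (p t) (deriv s t) := hηp.clm_apply hs'
  have hG₁ : ContDiff ℝ ∞ fun t ↦ S (η (p t) (deriv u t)) (u t) :=
    (S.contDiff.comp hg₁).clm_apply hu
  have hG₂ : ContDiff ℝ ∞ fun t ↦ S (η (p t) (deriv s t)) (s t) :=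
    (S.contDiff.comp hg₂).clm_apply hs
  have hderiv : deriv p = fun t ↦ S (η (p t) (deriv u t)) (u t) - S (η (p t) (deriv s t)) (s t) := by
    funext t
    rw [hode t, hS, ContinuousLinearMap.lsmul_apply, ContinuousLinearMap.lsmul_apply]
  -- induction on the order: all orders `1 … m` at once
  suffices H : ∀ m ≤ k, ∀ j, 1 ≤ j → j ≤ m → Tendsto (fun t ↦ iteratedDeriv j p t) atTop (𝓝 0) from
    fun m hm1 hmk ↦ H m hmk m hm1 le_rfl
  intro m
  induction m with
  | zero => intro _ j hj1 hj0; omega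
  | succ m ih =>
    intro hmk j hj1 hjm
    have ih' := ih (Nat.le_of_succ_le hmk)
    rcases Nat.lt_or_ge j (m + 1) with hlt | hge
    · exact ih' j hj1 (Nat.lt_succ_iff.mp hlt)
    have hjm' : j = m + 1 := le_antisymm hjm hge
    subst hjm'
    -- eventual bounds on the derivatives of `p`, `u`, `s` of orders `≤ m`
    have hpB : ∀ i ≤ m, ∃ K : ℝ, ∀ᶠ t in atTop, ‖iteratedDeriv i p t‖ ≤ K := by
      intro i hi
      rcases Nat.eq_zero_or_pos i with rfl | hi0
      · exact ⟨C, Eventually.of_forall fun t ↦ by simpa using hpb t⟩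
      · exact exists_eventually_norm_le_of_tendsto_zero (ih' i hi0 hi)
    have huB : ∀ i ≤ m, ∃ K : ℝ, ∀ᶠ t in atTop, ‖iteratedDeriv i u t‖ ≤ K := by
      intro i hi
      rcases Nat.eq_zero_or_pos i with rfl | hi0
      · exact ⟨C, Eventually.of_forall fun t ↦ by simpa using hub t⟩
      · exact exists_eventually_norm_le_of_tendsto_zero (hu0 i hi0 (by omega))
    have hsB : ∀ i ≤ m, ∃ K : ℝ, ∀ᶠ t in atTop, ‖iteratedDeriv i s t‖ ≤ K := by
      intro i hi
      rcases Nat.eq_zero_or_pos i with rfl | hi0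
      · exact ⟨C, Eventually.of_forall fun t ↦ by simpa using hsb t⟩
      · exact exists_eventually_norm_le_of_tendsto_zero (hs0 i hi0 (by omega))
    -- derivatives of `u'`, `s'` of orders `≤ m` tend to `0`
    have hu'0 : ∀ i ≤ m, Tendsto (fun t ↦ iteratedDeriv i (deriv u) t) atTop (𝓝 0) := by
      intro i hi
      have := hu0 (i + 1) (by omega) (by omega)
      simpa only [iteratedDeriv_succ'] using this
    have hs'0 : ∀ i ≤ m, Tendsto (fun t ↦ iteratedDeriv i (deriv s) t) atTop (𝓝 0) := by
      intro i hi
      have := hs0 (i + 1) (by omega) (by omega)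
      simpa only [iteratedDeriv_succ'] using this
    -- the scalar factors `η(p, u')`, `η(p, s')` and all their derivatives of order `≤ m` tend to `0`
    have hη₁ : ∀ i ≤ m, Tendsto (fun t ↦ iteratedDeriv i (fun t ↦ η (p t) (deriv u t)) t) atTop
        (𝓝 0) := fun i hi ↦
      tendsto_iteratedDeriv_bilinear_zero η hp hu' i (fun l hl ↦ hpB l (hl.trans hi))
        (fun l hl ↦ hu'0 l (hl.trans hi))
    have hη₂ : ∀ i ≤ m, Tendsto (fun t ↦ iteratedDeriv i (fun t ↦ η (p t) (deriv s t)) t) atTop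
        (𝓝 0) := fun i hi ↦
      tendsto_iteratedDeriv_bilinear_zero η hp hs' i (fun l hl ↦ hpB l (hl.trans hi))
        (fun l hl ↦ hs'0 l (hl.trans hi))
    -- hence both terms of `p'` and their derivatives of order `m` tend to `0`
    have hT₁ : Tendsto (fun t ↦ iteratedDeriv m (fun t ↦ S (η (p t) (deriv u t)) (u t)) t) atTop
        (𝓝 0) :=
      tendsto_iteratedDeriv_bilinear_zero' S hg₁ hu m hη₁ huB
    have hT₂ : Tendsto (fun t ↦ iteratedDeriv m (fun t ↦ S (η (p t) (deriv s t)) (s t)) t) atTop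
        (𝓝 0) :=
      tendsto_iteratedDeriv_bilinear_zero' S hg₂ hs m hη₂ hsB
    have heq : ∀ t, iteratedDeriv (m + 1) p t =
        iteratedDeriv m (fun t ↦ S (η (p t) (deriv u t)) (u t)) t -
          iteratedDeriv m (fun t ↦ S (η (p t) (deriv s t)) (s t)) t := by
      intro t
      rw [iteratedDeriv_succ', hderiv]
      exact iteratedDeriv_fun_sub (hG₁.of_le (by exact_mod_cast le_top)).contDiffAt
        (hG₂.of_le (by exact_mod_cast le_top)).contDiffAt
    simp only [heq]
    simpa using hT₁.sub hT₂

/-- Registered sub-goal form (stub `tendsto_iteratedDeriv_of_transport` of the crux item) of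
`tendsto_iteratedDeriv_of_transport'`: transport decay. [folklore] -/
theorem tendsto_iteratedDeriv_of_transport : open Literature.Geometry.Lorentzian Filter Topology in ∀ {u s p : ℝ → E4} {C : ℝ} (k : ℕ), ContDiff ℝ ((⊤ : ℕ∞) : WithTop ℕ∞) u → ContDiff ℝ ((⊤ : ℕ∞) : WithTop ℕ∞) s → ContDiff ℝ ((⊤ : ℕ∞) : WithTop ℕ∞) p → (∀ t, ‖u t‖ ≤ C) → (∀ t, ‖s t‖ ≤ C) → (∀ t, ‖p t‖ ≤ C) → (∀ t, deriv p t = (Minkowski.bilin (p t) (deriv u t)) • u t - (Minkowski.bilin (p t) (deriv s t)) • s t) → (∀ m : ℕ, 1 ≤ m → m ≤ k → Tendsto (fun t ↦ iteratedDeriv m u t) atTop (𝓝 0)) → (∀ m : ℕ, 1 ≤ m → m ≤ k → Tendsto (fun t ↦ iteratedDeriv m s t) atTop (𝓝 0)) → ∀ m : ℕ, 1 ≤ m → m ≤ k → Tendsto (fun t ↦ iteratedDeriv m p t) atTop (𝓝 0) :=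
  fun k hu hs hp hub hsb hpb hode hu0 hs0 ↦
    tendsto_iteratedDeriv_of_transport' k hu hs hp hub hsb hpb hode hu0 hs0

end Summit.FinalStateConjecture.FinalStateConjecture.Theorems.SublinearIsFree.Rechart

end
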